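import Summits.CriticalPhenomena.PercolationContinuityZ3.Theorems.SahiMasterFamilyPhiSymmetric
import Summits.CriticalPhenomena.PercolationContinuityZ3.Theorems.SahiMasterFamilyPhiSecondOrder

/-!
# The order-16 witness against `F(16)` is not the moment function of any union-closed-valued random family
# (so it is NOT a counterexample to Sahi's `C_16`): the one-missing-face inequality in expectation

Unit `prim-masterthm-p4` (gen 15; crux anchor stmt-CriticalPhenomena-4575, helper work; memo
`run/shared/lean/prim/prim-masterthm/prim-masterthm-p4/P4-GEN15-REPORT.md` §2).  Companion of `…PhiSymmetric` (the witness `f16`,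
`not_phiNonneg_sixteen`) and `…PhiSecondOrder` (`sum_indicator_erase_le_of_unionClosed`, the pointwise face inequality).

Every family of events relevant to Sahi's conjecture on the principal-cap stratum induces a G-SYSTEM (memo §2): a random
union-closed family `𝒢(x)` of index sets, with conditional moments `β_S = P(S ∈ 𝒢)`.  For EVERY probability weight and every
union-closed-valued `𝒢` these moments satisfy the linear ONE-MISSING-FACE inequalities
`Σ_{i∈B} β_{B∖i} ≤ 1 + (|B|−1)·β_B` (`sum_ex_indicator_erase_le`, by averaging the pointwise count).  The symmetric parity witness of
`…PhiSymmetric` violates it on any 6-set (`6·(199/200) > 1 + 5·(199/200)²`), hence `f16_not_momentFunction`: **no union-closed-valued random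
family (in particular no principal-cap family of increasing events, under any product measure) has the witness as its moment function.**
HONEST FRAMING: this is the formal content of "¬F(16) does not touch Sahi's `C_16`"; `C_k`, PC-k (`k ≥ 8`) and the master theorem remain OPEN.
Axioms standard. [this work]
-/

noncomputable section

open scoped Classical

namespace Summit.CriticalPhenomena.PercolationContinuityZ3.Theorems

namespace PhiNotEvent

open Finset
open Literature.Combinatorics.Sahi2008

/-- **One-missing-face inequality in expectation.**  For any probability weight `μ ≥ 0`, `Σ μ = 1`, and any union-closed-valued random
family `𝒢`, the moments `β_S = E 1[S ∈ 𝒢]` satisfy `Σ_{i∈B} β_{B∖i} ≤ 1 + (|B|−1)·β_B`. [this work] -/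
theorem sum_ex_indicator_erase_le {α ι : Type*} [Fintype α] [DecidableEq ι] (μ : α → ℝ) (hμ0 : ∀ x, 0 ≤ μ x)
    (hμ1 : ∑ x, μ x = 1) (𝒢 : α → Finset (Finset ι)) (hUC : ∀ x, ∀ A ∈ 𝒢 x, ∀ A' ∈ 𝒢 x, A ∪ A' ∈ 𝒢 x) (B : Finset ι) :
    ∑ i ∈ B, ex μ (fun x => if B.erase i ∈ 𝒢 x then (1 : ℝ) else 0) ≤
      1 + ((B.card : ℝ) - 1) * ex μ (fun x => if B ∈ 𝒢 x then (1 : ℝ) else 0) := by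
  have hlin : ∑ i ∈ B, ex μ (fun x => if B.erase i ∈ 𝒢 x then (1 : ℝ) else 0) =
      ex μ (fun x => ∑ i ∈ B, if B.erase i ∈ 𝒢 x then (1 : ℝ) else 0) := by
    simp only [ex_def]
    rw [sum_comm]
    exact sum_congr rfl fun x _ => by rw [mul_sum]
  have hrhs : 1 + ((B.card : ℝ) - 1) * ex μ (fun x => if B ∈ 𝒢 x then (1 : ℝ) else 0) =
      ex μ (fun x => 1 + ((B.card : ℝ) - 1) * (if B ∈ 𝒢 x then (1 : ℝ) else 0)) := by
    have e1 : ex μ (fun x => 1 + ((B.card : ℝ) - 1) * (if B ∈ 𝒢 x then (1 : ℝ) else 0)) =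
        ∑ x, μ x + ((B.card : ℝ) - 1) * ∑ x, μ x * (if B ∈ 𝒢 x then (1 : ℝ) else 0) := by
      rw [ex_def, mul_sum, ← sum_add_distrib]
      exact sum_congr rfl fun x _ => by ring
    rw [e1, hμ1, ex_def]
  rw [hlin, hrhs]
  exact ex_mono hμ0 fun x => PhiSecondOrder.sum_indicator_erase_le_of_unionClosed (𝒢 x) (hUC x) B

/-- The 6-set `{0,…,5} ⊆ Fin 16` used to test the face inequality. [this work] -/
theorem card_six : (({0, 1, 2, 3, 4, 5} : Finset (Fin 16))).card = 6 := by decide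

/-- **The order-16 witness is not a moment function of any union-closed-valued random family** (so `¬F(16)` says nothing about Sahi's
`C_16`): it violates the face inequality on every 6-set, `6·(199/200) > 1 + 5·(199/200)²`. [this work] -/
theorem f16_not_momentFunction {α : Type*} [Fintype α] (μ : α → ℝ) (hμ0 : ∀ x, 0 ≤ μ x) (hμ1 : ∑ x, μ x = 1)
    (𝒢 : α → Finset (Finset (Fin 16))) (hUC : ∀ x, ∀ A ∈ 𝒢 x, ∀ A' ∈ 𝒢 x, A ∪ A' ∈ 𝒢 x) :
    ¬ ∀ S : Finset (Fin 16), ex μ (fun x => if S ∈ 𝒢 x then (1 : ℝ) else 0) = PhiSymmetric.f16 S.card := by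
  intro h
  set B : Finset (Fin 16) := {0, 1, 2, 3, 4, 5} with hB
  have hcard : B.card = 6 := card_six
  have key := sum_ex_indicator_erase_le μ hμ0 hμ1 𝒢 hUC B
  have herase : ∀ i ∈ B, ex μ (fun x => if B.erase i ∈ 𝒢 x then (1 : ℝ) else 0) = PhiSymmetric.f16 5 := by
    intro i hi
    rw [h (B.erase i), card_erase_of_mem hi, hcard]
  have e1 : ∑ i ∈ B, ex μ (fun x => if B.erase i ∈ 𝒢 x then (1 : ℝ) else 0) = 6 * PhiSymmetric.f16 5 := by
    rw [sum_congr rfl herase, sum_const, hcard, nsmul_eq_mul]; norm_num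
  have e2 : ex μ (fun x => if B ∈ 𝒢 x then (1 : ℝ) else 0) = PhiSymmetric.f16 6 := by rw [h B, hcard]
  have e3 : ((B.card : ℝ) - 1) = 5 := by rw [hcard]; norm_num
  rw [e1, e2, e3] at key
  norm_num [PhiSymmetric.f16, PhiSymmetric.symProfile] at key

end PhiNotEvent

end Summit.CriticalPhenomena.PercolationContinuityZ3.Theorems
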